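import Summits.CriticalPhenomena.PercolationContinuityZ3.Theorems.PercNearOneGluingNoHeavyQuantFarSunTKTwoChain
import Summits.CriticalPhenomena.PercolationContinuityZ3.Theorems.PercNearOneGluingNoHeavyQuantFarSunRow
import HarnessLib

/-!
# FAR beyond trees: **`HairyCycle.SunFAR K 1` FOR EVERY `K ≥ 4`** — the closed-form two-copy certificate `T_K` at law level

builds on p205010 (kernel theorem, internal audit signed; external expert review pending)

Support file (`--supports stmt-CriticalPhenomena-4575`), seat `prim-cert-1` (gen 23); memo `prim-cert-1/FROM-prim-cert-1-g23-SUNFAR-ALL-K.md`.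
* `TK.tcE_*`, `TK.tcE2_*` — linearity, products, monotonicity of the (two-copy) two-chain expectations.
* `TK.two_mul_tcE2_Fcert` — `2 · E_{μ⊗μ} F_{T_K}(R;R') = E_{μ⊗μ} W` (`W = F + F∘swap`; with `TK.tcE2_Wcert_nonneg` this gives `E F ≥ 0`).
* `TK.tcE2_Fcert_eq` — the certificate identity `E F = Σ_k ā_k·(P(k ∉ R) − P(N ≤ 1)) − b̄·(EN − 2)`.
* **`HairyCycle.sunFAR_one_of_four_le`** — `4 ≤ K → SunFAR K 1`: the layer-one far-relay row on the sun graph with `K` hairs, for EVERY `K ≥ 4`;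
  **`HairyCycle.farRelayRow_layerOne_hairyCycle_of_four_le` / `_ring_of_four_le`** — the body of `Quant.FarRelayRow` at layer one on
  every hairy cycle (`IsHairyCycle`) and every ring (`IsHairyCycleD`) with `K ≥ 4` relays, all lengths and weights (gen 20's bridge
  `farRelayRow_*_of_sunFAR`).  The all-`K` statements (adding gen 18's computational certificates for `K ≤ 7`) are in the companion file
  `…QuantFarSunTKFinalAllK`.
No sorries; standard axioms only (no `native_decide`).  [this work]; the row itself: [cite: KozmaNitzan2024, Conjecture 3 (p. 15)] (context).
-/

noncomputable section

namespace Summit.CriticalPhenomena.PercolationContinuityZ3.Theorems.HairyCycle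

namespace TK

open Finset

variable {K : ℕ}

/-! ## One-copy expectations -/

/-- `tcE` only sees subsets of `range K`. [this work] -/
theorem tcE_congr {g h : ℕ → ℝ} {f f' : Finset ℕ → ℝ} (hf : ∀ R, R ⊆ range K → f R = f' R) : tcE K g h f = tcE K g h f' := by
  unfold tcE
  refine Finset.sum_congr rfl fun Q hQ => Finset.sum_congr rfl fun l _ => Finset.sum_congr rfl fun l' _ => ?_
  rw [Finset.mem_powerset] at hQ
  rw [hf _ (Finset.inter_subset_left.trans hQ)]

/-- Linearity: `tcE (a·f + b·f') = a·tcE f + b·tcE f'`. [this work] -/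
theorem tcE_lin (g h : ℕ → ℝ) (a b : ℝ) (f f' : Finset ℕ → ℝ) :
    tcE K g h (fun R => a * f R + b * f' R) = a * tcE K g h f + b * tcE K g h f' := by
  unfold tcE
  simp only [Finset.mul_sum, ← Finset.sum_add_distrib]
  refine Finset.sum_congr rfl fun Q _ => Finset.sum_congr rfl fun l _ => Finset.sum_congr rfl fun l' _ => by ring

/-- `tcE` of a finite sum of functions. [this work] -/
theorem tcE_sum (g h : ℕ → ℝ) (s : Finset ℕ) (f : ℕ → Finset ℕ → ℝ) :
    tcE K g h (fun R => ∑ k ∈ s, f k R) = ∑ k ∈ s, tcE K g h (f k) := by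
  unfold tcE
  calc ∑ Q ∈ (range K).powerset, ∑ l ∈ range (K + 2), ∑ l' ∈ range (K + 1),
        hairW K h Q * aL K g l * bM K g l' * ∑ k ∈ s, f k (Q ∩ cov K l l')
      = ∑ Q ∈ (range K).powerset, ∑ l ∈ range (K + 2), ∑ l' ∈ range (K + 1), ∑ k ∈ s,
        hairW K h Q * aL K g l * bM K g l' * f k (Q ∩ cov K l l') :=
        Finset.sum_congr rfl fun _ _ => Finset.sum_congr rfl fun _ _ => Finset.sum_congr rfl fun _ _ => Finset.mul_sum _ _ _
    _ = ∑ Q ∈ (range K).powerset, ∑ l ∈ range (K + 2), ∑ k ∈ s, ∑ l' ∈ range (K + 1),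
        hairW K h Q * aL K g l * bM K g l' * f k (Q ∩ cov K l l') :=
        Finset.sum_congr rfl fun _ _ => Finset.sum_congr rfl fun _ _ => Finset.sum_comm
    _ = ∑ Q ∈ (range K).powerset, ∑ k ∈ s, ∑ l ∈ range (K + 2), ∑ l' ∈ range (K + 1),
        hairW K h Q * aL K g l * bM K g l' * f k (Q ∩ cov K l l') :=
        Finset.sum_congr rfl fun _ _ => Finset.sum_comm
    _ = ∑ k ∈ s, ∑ Q ∈ (range K).powerset, ∑ l ∈ range (K + 2), ∑ l' ∈ range (K + 1),
        hairW K h Q * aL K g l * bM K g l' * f k (Q ∩ cov K l l') := Finset.sum_comm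

/-- `tcE` of a constant (the weights sum to one). [this work] -/
theorem tcE_const (g h : ℕ → ℝ) (c : ℝ) : tcE K g h (fun _ => c) = c := by
  unfold tcE
  have : ∑ Q ∈ (range K).powerset, ∑ l ∈ range (K + 2), ∑ l' ∈ range (K + 1), hairW K h Q * aL K g l * bM K g l' * c =
      (∑ Q ∈ (range K).powerset, hairW K h Q) * ((∑ l ∈ range (K + 2), aL K g l) * (∑ l' ∈ range (K + 1), bM K g l')) * c := by
    rw [Finset.sum_mul, Finset.sum_mul]
    refine Finset.sum_congr rfl fun Q _ => ?_
    rw [Finset.sum_mul_sum, Finset.mul_sum, Finset.sum_mul]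
    refine Finset.sum_congr rfl fun l _ => ?_
    rw [Finset.mul_sum, Finset.sum_mul]
    refine Finset.sum_congr rfl fun l' _ => by ring
  rw [this, sum_hairW_eq_one, sum_aL, sum_bM]; ring

/-- Monotonicity of `tcE` for `g, h ∈ [0,1]` (on subsets of `range K`). [this work] -/
theorem tcE_mono {g h : ℕ → ℝ} (hg : ∀ m, m ≤ K → 0 ≤ g m ∧ g m ≤ 1) (hh : ∀ k, k < K → 0 ≤ h k ∧ h k ≤ 1)
    {f f' : Finset ℕ → ℝ} (hf : ∀ R, R ⊆ range K → f R ≤ f' R) : tcE K g h f ≤ tcE K g h f' := by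
  unfold tcE
  refine Finset.sum_le_sum fun Q hQ => Finset.sum_le_sum fun l _ => Finset.sum_le_sum fun l' hl' => ?_
  rw [Finset.mem_powerset] at hQ
  rw [Finset.mem_range] at hl'
  exact mul_le_mul_of_nonneg_left (hf _ (Finset.inter_subset_left.trans hQ))
    (mul_nonneg (mul_nonneg (hairW_nonneg hh Q) (aL_nonneg hg l)) (bM_nonneg hg (by omega)))

/-- `tcE f ≥ 0` for `f ≥ 0` on subsets of `range K` (`g, h ∈ [0,1]`). [this work] -/
theorem tcE_nonneg {g h : ℕ → ℝ} (hg : ∀ m, m ≤ K → 0 ≤ g m ∧ g m ≤ 1) (hh : ∀ k, k < K → 0 ≤ h k ∧ h k ≤ 1)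
    {f : Finset ℕ → ℝ} (hf : ∀ R, R ⊆ range K → 0 ≤ f R) : 0 ≤ tcE K g h f := by
  have := tcE_mono hg hh (f := fun _ => (0 : ℝ)) (f' := f) (fun R hR => hf R hR)
  rwa [tcE_const] at this

/-! ## Two-copy expectations -/

/-- Product functions: `tcE2 (f ⊗ f') = tcE f · tcE f'`. [this work] -/
theorem tcE2_prod (g h : ℕ → ℝ) (f f' : Finset ℕ → ℝ) :
    tcE2 K g h (fun R R' => f R * f' R') = tcE K g h f * tcE K g h f' := by
  unfold tcE2 tcE
  rw [Finset.sum_mul_sum]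
  refine Finset.sum_congr rfl fun Q _ => Finset.sum_congr rfl fun Q' _ => ?_
  rw [Finset.sum_mul]
  refine Finset.sum_congr rfl fun l _ => ?_
  rw [Finset.sum_mul]
  refine Finset.sum_congr rfl fun l' _ => ?_
  rw [Finset.mul_sum]
  refine Finset.sum_congr rfl fun m _ => ?_
  rw [Finset.mul_sum]
  refine Finset.sum_congr rfl fun m' _ => by ring

/-- Linearity of `tcE2`. [this work] -/
theorem tcE2_lin (g h : ℕ → ℝ) (a b : ℝ) (F G : Finset ℕ → Finset ℕ → ℝ) :
    tcE2 K g h (fun R R' => a * F R R' + b * G R R') = a * tcE2 K g h F + b * tcE2 K g h G := by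
  unfold tcE2
  simp only [Finset.mul_sum, ← Finset.sum_add_distrib]
  refine Finset.sum_congr rfl fun _ _ => Finset.sum_congr rfl fun _ _ => Finset.sum_congr rfl fun _ _ =>
    Finset.sum_congr rfl fun _ _ => Finset.sum_congr rfl fun _ _ => Finset.sum_congr rfl fun _ _ => by ring

/-- `tcE2` of a finite sum of functions. [this work] -/
theorem tcE2_sum (g h : ℕ → ℝ) (s : Finset ℕ) (F : ℕ → Finset ℕ → Finset ℕ → ℝ) :
    tcE2 K g h (fun R R' => ∑ k ∈ s, F k R R') = ∑ k ∈ s, tcE2 K g h (F k) := by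
  induction s using Finset.induction_on with
  | empty =>
    simp only [Finset.sum_empty]
    have := tcE2_lin (K := K) g h 0 0 (fun _ _ => 0) (fun _ _ => 0)
    simp only [zero_mul, add_zero] at this
    exact this
  | insert k s hk ih =>
    rw [Finset.sum_insert hk, ← ih]
    have := tcE2_lin (K := K) g h 1 1 (F k) (fun R R' => ∑ k ∈ s, F k R R')
    simp only [one_mul] at this
    rw [← this]
    exact congrArg _ (funext fun R => funext fun R' => Finset.sum_insert hk)

/-- Exchanging the two copies does not change `tcE2`. [this work] -/
theorem tcE2_swap (g h : ℕ → ℝ) (F : Finset ℕ → Finset ℕ → ℝ) :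
    tcE2 K g h (fun R R' => F R' R) = tcE2 K g h F := by
  unfold tcE2
  rw [Finset.sum_comm]
  refine Finset.sum_congr rfl fun Q _ => Finset.sum_congr rfl fun Q' _ => ?_
  calc ∑ l ∈ range (K + 2), ∑ l' ∈ range (K + 1), ∑ m ∈ range (K + 2), ∑ m' ∈ range (K + 1),
        hairW K h Q' * hairW K h Q * (aL K g l * bM K g l' * (aL K g m * bM K g m')) * F (Q ∩ cov K m m') (Q' ∩ cov K l l')
      = ∑ l ∈ range (K + 2), ∑ m ∈ range (K + 2), ∑ l' ∈ range (K + 1), ∑ m' ∈ range (K + 1),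
        hairW K h Q' * hairW K h Q * (aL K g l * bM K g l' * (aL K g m * bM K g m')) * F (Q ∩ cov K m m') (Q' ∩ cov K l l') :=
        Finset.sum_congr rfl fun _ _ => Finset.sum_comm
    _ = ∑ m ∈ range (K + 2), ∑ l ∈ range (K + 2), ∑ l' ∈ range (K + 1), ∑ m' ∈ range (K + 1),
        hairW K h Q' * hairW K h Q * (aL K g l * bM K g l' * (aL K g m * bM K g m')) * F (Q ∩ cov K m m') (Q' ∩ cov K l l') :=
        Finset.sum_comm
    _ = ∑ m ∈ range (K + 2), ∑ l ∈ range (K + 2), ∑ m' ∈ range (K + 1), ∑ l' ∈ range (K + 1),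
        hairW K h Q' * hairW K h Q * (aL K g l * bM K g l' * (aL K g m * bM K g m')) * F (Q ∩ cov K m m') (Q' ∩ cov K l l') :=
        Finset.sum_congr rfl fun _ _ => Finset.sum_congr rfl fun _ _ => Finset.sum_comm
    _ = ∑ m ∈ range (K + 2), ∑ m' ∈ range (K + 1), ∑ l ∈ range (K + 2), ∑ l' ∈ range (K + 1),
        hairW K h Q' * hairW K h Q * (aL K g l * bM K g l' * (aL K g m * bM K g m')) * F (Q ∩ cov K m m') (Q' ∩ cov K l l') :=
        Finset.sum_congr rfl fun _ _ => Finset.sum_comm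
    _ = ∑ m ∈ range (K + 2), ∑ m' ∈ range (K + 1), ∑ l ∈ range (K + 2), ∑ l' ∈ range (K + 1),
        hairW K h Q * hairW K h Q' * (aL K g m * bM K g m' * (aL K g l * bM K g l')) * F (Q ∩ cov K m m') (Q' ∩ cov K l l') :=
        Finset.sum_congr rfl fun _ _ => Finset.sum_congr rfl fun _ _ => Finset.sum_congr rfl fun _ _ =>
          Finset.sum_congr rfl fun _ _ => by ring

/-- **`2 · E_{μ⊗μ} F_{T_K}(R; R') = E_{μ⊗μ} W_{T_K}(R; R')`** for the two-chain law (`W = F + F∘swap`, the copies are exchangeable). [this work] -/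
theorem two_mul_tcE2_Fcert (g h : ℕ → ℝ) :
    2 * tcE2 K g h (fun R R' => (Fcert K R R' : ℝ)) = tcE2 K g h (fun R R' => (Wcert K R R' : ℝ)) := by
  have hsw := tcE2_swap (K := K) g h (fun R R' => (Fcert K R R' : ℝ))
  have hlin := tcE2_lin (K := K) g h 1 1 (fun R R' => (Fcert K R R' : ℝ)) (fun R R' => (Fcert K R' R : ℝ))
  have hWdef : tcE2 K g h (fun R R' => (Wcert K R R' : ℝ)) = tcE2 K g h (fun R R' => 1 * (Fcert K R R' : ℝ) + 1 * (Fcert K R' R : ℝ)) := by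
    congr 1; ext R R'; unfold Wcert; push_cast; ring
  rw [hWdef, hlin, hsw]
  ring

/-! ## The certificate coefficients -/

/-- `a_k(R') ≥ 0` for `R' ⊆ range K`, `2 ≤ K`. [this work] -/
theorem aCoef_nonneg (hK : 2 ≤ K) (k : ℕ) {R' : Finset ℕ} (hR : R' ⊆ range K) : (0 : ℝ) ≤ (aCoef K k R' : ℝ) := by
  have hc : R'.card ≤ K := by simpa using Finset.card_le_card hR
  have h2 : (2 : ℝ) ≤ K := by exact_mod_cast hK
  have hc' : (R'.card : ℝ) ≤ K := by exact_mod_cast hc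
  unfold aCoef
  split_ifs <;> push_cast <;> linarith

/-- `b(R') ≥ 0`. [this work] -/
theorem bCoef_nonneg (R' : Finset ℕ) : (0 : ℝ) ≤ (bCoef K R' : ℝ) := by
  unfold bCoef; split_ifs <;> norm_num

/-- At an interior index `u` the ghost's bet dominates `𝟙[|R'| ≤ 1]`. [this work] -/
theorem low_le_aCoef {u : ℕ} (hu0 : u ≠ 0) (huK : u ≠ K - 1) {R' : Finset ℕ} (hR : R' ⊆ range K) :
    (if R'.card ≤ 1 then (1 : ℝ) else 0) ≤ (aCoef K u R' : ℝ) := by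
  have hc : R'.card ≤ K := by simpa using Finset.card_le_card hR
  have hne : ¬ (u = 0 ∨ u = K - 1) := by omega
  unfold aCoef
  rw [if_neg hne]
  generalize hcd : R'.card = c at hc ⊢
  have hc' : (c : ℝ) ≤ K := by exact_mod_cast hc
  rcases c with _ | _ | c
  · norm_num
  · norm_num
  · have h2 : ¬ (c + 1 + 1 ≤ 1) := by omega
    have hK' : (c : ℝ) + 1 + 1 ≤ K := by push_cast at hc'; linarith
    simp only [h2, if_false, Nat.add_eq_zero_iff, one_ne_zero, and_false, Nat.add_eq_one_iff, and_self]
    split_ifs <;> push_cast <;> linarith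

/-! ## The main theorem -/

open scoped Classical in
/-- **`SunFAR K 1` FOR EVERY `K ≥ 4`**: FAR at layer one on the sun graph with `K` hairs, all cycle-edge and hair weights — via the
closed-form two-copy certificate `T_K` at law level (memo `FROM-prim-cert-1-g23-SUNFAR-ALL-K.md`). [this work] -/
theorem sunFAR_one_of_four_le (hK : 4 ≤ K) : SunFAR K 1 := by
  intro g h hg hh hEN t ht
  have hK2 : 2 ≤ K := by omega
  -- the one-copy quantities as two-chain expectations
  set P1 : ℝ := sunLaw K g h (fun R => R.card ≤ 1) with hP1
  have eP1 : P1 = tcE K g h (fun R => if R.card ≤ 1 then 1 else 0) := by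
    rw [hP1, sunLaw_eq_tcE]; exact tcE_congr fun R _ => by congr
  have eq_k : ∀ k, k < K → tcE K g h (fun R => if k ∉ R then (1 : ℝ) else 0) = 1 - sunMarg K g h k := by
    intro k hk
    rw [← sunLaw_mem_eq_sunMarg hK2 hg hh hk, ← sunLaw_not hK2 hg hh, sunLaw_eq_tcE]
    exact tcE_congr fun R _ => by congr
  have eEN : tcE K g h (fun R => (R.card : ℝ)) = ∑ k ∈ range K, sunMarg K g h k := by
    have e1 : tcE K g h (fun R => (R.card : ℝ)) = tcE K g h (fun R => ∑ k ∈ range K, if k ∈ R then (1 : ℝ) else 0) := by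
      refine tcE_congr fun R hR => ?_
      rw [Finset.sum_ite_mem, Finset.inter_eq_right.2 hR, Finset.sum_const, nsmul_eq_mul, mul_one]
    rw [e1, tcE_sum]
    refine Finset.sum_congr rfl fun k hk => ?_
    rw [Finset.mem_range] at hk
    rw [← sunLaw_mem_eq_sunMarg hK2 hg hh hk, sunLaw_eq_tcE]
    exact tcE_congr fun R _ => by congr
  -- the certificate identity
  set abar : ℕ → ℝ := fun k => tcE K g h (fun R' => (aCoef K k R' : ℝ)) with habar
  set bbar : ℝ := tcE K g h (fun R' => (bCoef K R' : ℝ)) with hbbar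
  have hF : tcE2 K g h (fun R R' => (Fcert K R R' : ℝ)) =
      ∑ k ∈ range K, (tcE K g h (fun R => if k ∉ R then (1 : ℝ) else 0) - P1) * abar k -
        (tcE K g h (fun R => (R.card : ℝ)) - 2) * bbar := by
    have epoint : (fun R R' => (Fcert K R R' : ℝ)) = fun R R' =>
        1 * (∑ k ∈ range K, (aCoef K k R' : ℝ) * ((if k ∉ R then (1 : ℝ) else 0) - (if R.card ≤ 1 then (1 : ℝ) else 0))) +
          (-1) * ((bCoef K R' : ℝ) * ((R.card : ℝ) - 2)) := by
      ext R R'; unfold Fcert; push_cast; ring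
    have eA : ∀ k, tcE2 K g h (fun R R' => (aCoef K k R' : ℝ) * ((if k ∉ R then (1 : ℝ) else 0) - (if R.card ≤ 1 then (1 : ℝ) else 0))) =
        (tcE K g h (fun R => if k ∉ R then (1 : ℝ) else 0) - P1) * abar k := by
      intro k
      have e1 : (fun R R' : Finset ℕ => (aCoef K k R' : ℝ) * ((if k ∉ R then (1 : ℝ) else 0) - (if R.card ≤ 1 then (1 : ℝ) else 0))) =
          fun R R' => (1 * (if k ∉ R then (1 : ℝ) else 0) + (-1) * (if R.card ≤ 1 then (1 : ℝ) else 0)) * (aCoef K k R' : ℝ) := by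
        ext R R'; ring
      rw [e1, tcE2_prod, tcE_lin, ← eP1]; ring
    have eB : tcE2 K g h (fun R R' => (bCoef K R' : ℝ) * ((R.card : ℝ) - 2)) = (tcE K g h (fun R => (R.card : ℝ)) - 2) * bbar := by
      have e1 : (fun R R' : Finset ℕ => (bCoef K R' : ℝ) * ((R.card : ℝ) - 2)) =
          fun R R' => (1 * (R.card : ℝ) + (-2) * (1 : ℝ)) * (bCoef K R' : ℝ) := by
        ext R R'; ring
      rw [e1, tcE2_prod, tcE_lin, tcE_const]; ring
    rw [epoint, tcE2_lin, tcE2_sum, eB]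
    simp only [eA]
    ring
  -- signs
  have habar0 : ∀ k, 0 ≤ abar k := fun k => tcE_nonneg hg hh fun R' hR' => aCoef_nonneg hK2 k hR'
  have hbbar0 : 0 ≤ bbar := tcE_nonneg hg hh fun R' _ => bCoef_nonneg R'
  have hq : ∀ k ∈ range K, tcE K g h (fun R => if k ∉ R then (1 : ℝ) else 0) ≤ t := by
    intro k hk; rw [Finset.mem_range] at hk; rw [eq_k k hk]; exact ht k hk
  have ht0 : 0 ≤ t := by
    have h0 : 0 < K := by omega
    have := ht 0 h0
    have hm : sunMarg K g h 0 ≤ 1 := by rw [← sunLaw_mem_eq_sunMarg hK2 hg hh h0]; exact sunLaw_le_one hK2 hg hh _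
    linarith
  -- main inequality: Σ_k (q_k − P1)·ā_k ≥ (EN − 2)·b̄ ≥ 0
  have hmain : 0 ≤ ∑ k ∈ range K, (tcE K g h (fun R => if k ∉ R then (1 : ℝ) else 0) - P1) * abar k := by
    have h1 : 0 ≤ tcE2 K g h (fun R R' => (Fcert K R R' : ℝ)) := by
      have hW := tcE2_Wcert_nonneg hK hg hh
      have h2 := two_mul_tcE2_Fcert (K := K) g h
      linarith
    rw [hF, eEN] at h1
    have h2 : 0 ≤ (∑ k ∈ range K, sunMarg K g h k - 2) * bbar := mul_nonneg (by push_cast at hEN; linarith) hbbar0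
    linarith
  have hsum : 0 ≤ ∑ k ∈ range K, (t - P1) * abar k := by
    refine le_trans hmain (Finset.sum_le_sum fun k hk => ?_)
    exact mul_le_mul_of_nonneg_right (by linarith [hq k hk]) (habar0 k)
  rw [← Finset.mul_sum] at hsum
  -- either some ā_k > 0, or all vanish and then P(N ≤ 1) = 0
  by_cases hpos : 0 < ∑ k ∈ range K, abar k
  · refine le_of_not_gt fun hcon => ?_
    have : (t - P1) * ∑ k ∈ range K, abar k < 0 := mul_neg_of_neg_of_pos (by linarith) hpos
    linarith
  · have hzero : ∑ k ∈ range K, abar k = 0 := le_antisymm (not_lt.1 hpos) (Finset.sum_nonneg fun k _ => habar0 k)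
    have h1K : 1 ∈ range K := Finset.mem_range.2 (by omega)
    have ha1 : abar 1 = 0 := by
      have := Finset.sum_eq_zero_iff_of_nonneg (fun k _ => habar0 k) |>.1 hzero 1 h1K
      exact this
    have hP1le : P1 ≤ abar 1 := by
      rw [eP1]
      exact tcE_mono hg hh fun R' hR' => low_le_aCoef (K := K) (u := 1) one_ne_zero (by omega) hR'
    show P1 ≤ t
    linarith

end TK

/-- **FAR at layer one on the sun graph for every `K ≥ 4`** (route vocabulary alias of `TK.sunFAR_one_of_four_le`). [this work] -/
theorem sunFAR_one_of_four_le {K : ℕ} (hK : 4 ≤ K) : SunFAR K 1 := TK.sunFAR_one_of_four_le hK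

/-! ## The row on every hairy cycle and ring with `K ≥ 4` relays -/

section Rings

open MeasureTheory
open Literature.Probability.LatticeModels
open Literature.Probability.Percolation
open scoped Classical

variable {n : ℕ} {L : ℕ} {cyc : ℕ → Fin n} {K : ℕ} {base : ℕ → ℕ} {tip : ℕ → Fin n}

/-- **FAR at layer one on every hairy cycle with `K ≥ 4` hairs** (`IsHairyCycle L cyc K base tip`, any weight function supported on the
cycle and hair pairs): `2 < Σ_k P(c₀ ↔ t_k)` and `P(c₀ ↮ t_k) ≤ t` for all `k` imply `P(#{k : c₀ ↔ t_k} ≤ 1) ≤ t`.  Standard axioms. [this work] -/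
theorem farRelayRow_layerOne_hairyCycle_of_four_le (H : IsHairyCycle L cyc K base tip) (hK : 4 ≤ K) (w : Sym2 (Fin n) → unitInterval)
    (hsupp : ∀ e : Sym2 (Fin n), ¬ e.IsDiag → w e ≠ 0 →
      (∃ i, i < L ∧ e = cycE L cyc i) ∨ (∃ k, k < K ∧ e = hairE cyc base tip k))
    (t : ℝ)
    (hEN : (2 * (1 : ℕ) : ℝ) < ∑ a ∈ (Finset.range K).image tip, (prodBernoulli w).real (openConn (cyc 0) a))
    (hcut : ∀ a ∈ (Finset.range K).image tip, (prodBernoulli w).real (openConn (cyc 0) a)ᶜ ≤ t) :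
    (prodBernoulli w).real {ω : BondConfig (Fin n) |
      (((Finset.range K).image tip).filter fun a => ω ∈ openConn (cyc 0) a).card ≤ 1} ≤ t :=
  farRelayRow_hairyCycle_of_sunFAR H (sunFAR_one_of_four_le hK) w hsupp t hEN hcut

/-- **FAR at layer one on every ring with `K ≥ 4` relays** (`IsHairyCycleD`: relays at cycle vertices and/or on pendant hairs).
Standard axioms. [this work] -/
theorem farRelayRow_layerOne_ring_of_four_le (H : IsHairyCycleD L cyc K base tip) (hK : 4 ≤ K) (w : Sym2 (Fin n) → unitInterval)
    (hsupp : ∀ e : Sym2 (Fin n), ¬ e.IsDiag → w e ≠ 0 →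
      (∃ i, i < L ∧ e = cycE L cyc i) ∨ (∃ k, k < K ∧ e = hairE cyc base tip k))
    (t : ℝ)
    (hEN : (2 * (1 : ℕ) : ℝ) < ∑ a ∈ (Finset.range K).image tip, (prodBernoulli w).real (openConn (cyc 0) a))
    (hcut : ∀ a ∈ (Finset.range K).image tip, (prodBernoulli w).real (openConn (cyc 0) a)ᶜ ≤ t) :
    (prodBernoulli w).real {ω : BondConfig (Fin n) |
      (((Finset.range K).image tip).filter fun a => ω ∈ openConn (cyc 0) a).card ≤ 1} ≤ t :=
  farRelayRow_ring_of_sunFAR H (sunFAR_one_of_four_le hK) w hsupp t hEN hcut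

end Rings

end Summit.CriticalPhenomena.PercolationContinuityZ3.Theorems.HairyCycle

end
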